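import Literature.Topology.FourManifolds.GenericCircleStep
import Literature.Topology.FourManifolds.ImmersionCriterion
import Literature.Topology.FourManifolds.Isotopy
import Mathlib.Analysis.SpecialFunctions.Trigonometric.Bounds
import HarnessLib

/-!
# Whitney 1936 for circles: a smooth homotopy of embedded circles in dimension `≥ 4` can be
# perturbed to a smooth isotopy

Topic `Literature/Topology/FourManifolds`; the general-position half of the tree's proof of the
leaf `Literature.Topology.FourManifolds.Milnor1965_isAmbientIsotopic_of_simplyConnected` of
`HCobordismAuxiliaryPair.lean` (Milnor, *Lectures on the h-cobordism theorem* (1965), proof of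
Thm. 8.1 Index 1, PDF p. 56: *"Since `V₂₊` is simply connected, 8.4 and 5.8 imply that there is
an isotopy …"*, Thm. 8.4: *if two smooth imbeddings of `Mᵐ` into `Nⁿ` are homotopic, then they
are smoothly isotopic provided `n ≥ 2m + 3`*, Remark: *actually 8.4 holds with `n ≥ 2m + 2` (see
Whitney [16])* — here `m = 1`, `n ≥ 4`).

* `Literature.Topology.FourManifolds.isSmoothlyIsotopic_of_contMDiff_homotopy` — **Whitney's
  theorem for circles, general-position part.**  Let `V` be a Hausdorff manifold of dimension
  `n ≥ 4` without boundary, `e₀ e₁ : S¹ → V` smooth embeddings, and `H : ℝ × S¹ → V` a smooth map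
  with `H (t, ·) = e₀` for `t ≤ 1/4` and `H (t, ·) = e₁` for `t ≥ 3/4`.  Then `e₀` and `e₁` are
  smoothly isotopic (`Literature.Topology.FourManifolds.IsSmoothlyIsotopic`, `Isotopy.lean`).

**Proof** (H. Whitney, *Differentiable manifolds*, Ann. of Math. 37 (1936), §II Thm. 6 with
§§8–9; Hirsch, *Differential Topology* (1976), Ch. 3 §2 Thm. 2.5, Ch. 8 §1 Ex. 14).  Cover the
compact `[1/4, 3/4] × S¹` by finitely many compact rectangles `Kᵢ = [τᵢ - δ, τᵢ + δ] × (closed arc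
of angle `α` about `circlePoint cᵢ`)`, so small (Lebesgue number) that the concentric closed
rectangles of thrice the size are mapped by `H` into chart sources of `V`.  Starting from `H`,
whose stages are good (`StagesGoodOn`) on `A₀ = {t ≤ 1/4} ∪ {t ≥ 3/4}` because `e₀`, `e₁` are
embeddings, apply the generic step `exists_chartPerturb_stagesGoodOn` (`GenericCircleStep.lean`)
once for each rectangle: the stages become good on `A₀ ∪ K₁ ∪ ⋯ ∪ Kᵢ`, the thrice-size rectangles
stay in their chart sources, and nothing changes for `t ∉ (1/8, 7/8)`.  At the end every stage is
an injective map `S¹ → V` with nowhere vanishing velocity, hence a smooth embedding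
(`isSmoothEmbedding_of_injective_of_injective_mfderiv`, `ImmersionCriterion.lean`), and the
family is a smooth isotopy from `e₀` to `e₁`.  Everything here is proved; no definitions, no
named facts.

## References

* H. Whitney, *Differentiable manifolds*, Ann. of Math. (2) 37 (1936), 645–680, §II Thm. 6,
  §§8–9. [Whitney1936]
* J. Milnor, *Lectures on the h-cobordism theorem* (1965), Thm. 8.4 and Remark (PDF p. 56).
  [MilnorHCobordism1965]
* M. W. Hirsch, *Differential Topology*, GTM 33 (1976), Ch. 3 §2, Ch. 8 §1. [HirschDT1976]
-/

open scoped Manifold ContDiff Topology Real RealInnerProductSpace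
open Function Set Filter

noncomputable section

namespace Literature.Topology.FourManifolds

variable {n : ℕ} {V : Type*} [TopologicalSpace V] [ChartedSpace (EuclideanSpace ℝ (Fin n)) V]

/-! ### Stages with nonzero θ-velocity are immersions -/

section Stages

set_option backward.isDefEq.respectTransparency false in
/-- **An immersed circle has nonzero θ-velocity**: for a smooth immersion `e : S¹ → V`, the
time-independent family `(t, u) ↦ e u` has `thetaVel ≠ 0` everywhere (chain rule with
`mfderiv_circlePoint_apply_ne_zero` and the injectivity of `de`). [folklore] -/
theorem thetaVel_const_ne_zero {e : (Metric.sphere (0 : EuclideanSpace ℝ (Fin 2)) 1) → V} (he : ContMDiff (𝓡 1) (𝓡 n) ∞ e)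
    (himm : Manifold.IsImmersion (𝓡 1) (𝓡 n) ∞ e) (t s : ℝ) :
    thetaVel n (fun p : ℝ × (Metric.sphere (0 : EuclideanSpace ℝ (Fin 2)) 1) => e p.2) t s ≠ 0 := by
  have hn : (∞ : WithTop ℕ∞) ≠ 0 := by simp
  have hcomp : mfderiv 𝓘(ℝ, ℝ) (𝓡 n) (e ∘ circlePoint) s =
      (mfderiv (𝓡 1) (𝓡 n) e (circlePoint s)).comp (mfderiv 𝓘(ℝ, ℝ) (𝓡 1) circlePoint s) :=
    mfderiv_comp s (he.mdifferentiableAt hn) (contMDiff_circlePoint.mdifferentiableAt hn)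
  have hinj : Injective (mfderiv (𝓡 1) (𝓡 n) e (circlePoint s)) :=
    mfderiv_injective_of_isImmersion himm (by simp) (circlePoint s)
  intro h0
  have h1 : (mfderiv (𝓡 1) (𝓡 n) e (circlePoint s))
      (mfderiv 𝓘(ℝ, ℝ) (𝓡 1) circlePoint s (1 : ℝ)) = 0 := by
    have := congrArg (fun L : ℝ →L[ℝ] EuclideanSpace ℝ (Fin n) => L (1 : ℝ)) hcomp
    exact this.symm.trans h0
  exact mfderiv_circlePoint_apply_ne_zero s (hinj (h1.trans (map_zero _).symm))

set_option backward.isDefEq.respectTransparency false in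
/-- **Nonzero θ-velocity gives immersive stages**: if the smooth family `G` has
`thetaVel n G t s ≠ 0` for all `s`, then the stage `G (t, ·) : S¹ → V` has injective differential
at every point (`T S¹` is one-dimensional, spanned by the image of `d(circlePoint)`). [folklore] -/
theorem injective_mfderiv_stage {G : ℝ × (Metric.sphere (0 : EuclideanSpace ℝ (Fin 2)) 1) → V}
    (hG : ContMDiff (𝓘(ℝ, ℝ).prod (𝓡 1)) (𝓡 n) ∞ G) {t : ℝ} (h : ∀ s, thetaVel n G t s ≠ 0)
    (u : (Metric.sphere (0 : EuclideanSpace ℝ (Fin 2)) 1)) : Injective (mfderiv (𝓡 1) (𝓡 n) (fun u : (Metric.sphere (0 : EuclideanSpace ℝ (Fin 2)) 1) => G (t, u)) u) := by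
  obtain ⟨s, rfl⟩ := circlePoint_surjective u
  have hn : (∞ : WithTop ℕ∞) ≠ 0 := by simp
  have hf : ContMDiff (𝓡 1) (𝓡 n) ∞ fun u : (Metric.sphere (0 : EuclideanSpace ℝ (Fin 2)) 1) => G (t, u) :=
    hG.comp (contMDiff_const.prodMk contMDiff_id)
  set L := mfderiv (𝓡 1) (𝓡 n) (fun u : (Metric.sphere (0 : EuclideanSpace ℝ (Fin 2)) 1) => G (t, u)) (circlePoint s) with hL
  set v₀ : EuclideanSpace ℝ (Fin 1) := mfderiv 𝓘(ℝ, ℝ) (𝓡 1) circlePoint s (1 : ℝ) with hv₀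
  have hv₀ne : v₀ ≠ 0 := mfderiv_circlePoint_apply_ne_zero s
  have hcomp : mfderiv 𝓘(ℝ, ℝ) (𝓡 n) ((fun u : (Metric.sphere (0 : EuclideanSpace ℝ (Fin 2)) 1) => G (t, u)) ∘ circlePoint) s =
      L.comp (mfderiv 𝓘(ℝ, ℝ) (𝓡 1) circlePoint s) :=
    mfderiv_comp s (hf.mdifferentiableAt hn) (contMDiff_circlePoint.mdifferentiableAt hn)
  have hLv₀ : L v₀ ≠ 0 := by
    intro h0
    apply h s
    have := congrArg (fun M : ℝ →L[ℝ] EuclideanSpace ℝ (Fin n) => M (1 : ℝ)) hcomp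
    exact this.trans h0
  -- `T S¹ = ℝ¹` is spanned by `v₀`
  have hspan : ∀ w : EuclideanSpace ℝ (Fin 1), ∃ a : ℝ, a • v₀ = w :=
    (finrank_eq_one_iff_of_nonzero' v₀ hv₀ne).1 finrank_euclideanSpace_fin
  refine (injective_iff_map_eq_zero L).2 fun y hy => ?_
  obtain ⟨a, rfl⟩ := hspan y
  rw [map_smul] at hy
  rcases smul_eq_zero.1 hy with ha | hL0
  · rw [ha, zero_smul]
  · exact absurd hL0 hLv₀

variable [IsManifold (𝓡 n) ∞ V]

/-- **Good stages are smooth embeddings**: if the smooth family `G` is good on all of `ℝ × S¹`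
(`StagesGoodOn n G univ`) then every stage `G (t, ·) : S¹ → V` is a smooth embedding, for `V`
Hausdorff (`isSmoothEmbedding_of_injective_of_injective_mfderiv`: an injective immersion of the
compact circle). [folklore] -/
theorem isSmoothEmbedding_stage [T2Space V] {G : ℝ × (Metric.sphere (0 : EuclideanSpace ℝ (Fin 2)) 1) → V}
    (hG : ContMDiff (𝓘(ℝ, ℝ).prod (𝓡 1)) (𝓡 n) ∞ G) (h : StagesGoodOn n G univ) (t : ℝ) :
    Manifold.IsSmoothEmbedding (𝓡 1) (𝓡 n) ∞ fun u : (Metric.sphere (0 : EuclideanSpace ℝ (Fin 2)) 1) => G (t, u) := by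
  have hf : ContMDiff (𝓡 1) (𝓡 n) ∞ fun u : (Metric.sphere (0 : EuclideanSpace ℝ (Fin 2)) 1) => G (t, u) :=
    hG.comp (contMDiff_const.prodMk contMDiff_id)
  exact isSmoothEmbedding_of_injective_of_injective_mfderiv hf (by simp) (h.injective_stage t)
    (injective_mfderiv_stage hG fun s => h.1 t s (mem_univ _))

end Stages

/-! ### Metric size of arcs and the grid cover of `[1/4, 3/4] × S¹` -/

section Cover

/-- **Points of the closed arc of angle `β ≥ 0` are within distance `β` of its centre**
(`‖u - circlePoint c‖² = 2 - 2 cos ∠ ≤ 2 - 2 cos β ≤ β²`). [folklore] -/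
theorem dist_le_of_mem_circleClosedArc {c β : ℝ} (hβ : 0 ≤ β) {u : (Metric.sphere (0 : EuclideanSpace ℝ (Fin 2)) 1)}
    (hu : u ∈ circleClosedArc c β) : dist u (circlePoint c) ≤ β := by
  have hcos := mem_circleClosedArc.1 hu
  have hu1 : ⟪((u : (Metric.sphere (0 : EuclideanSpace ℝ (Fin 2)) 1)) : EuclideanSpace ℝ (Fin 2)), ((u : (Metric.sphere (0 : EuclideanSpace ℝ (Fin 2)) 1)) : EuclideanSpace ℝ (Fin 2))⟫ = 1 := by
    rw [real_inner_self_eq_norm_sq, norm_eq_of_mem_sphere u, one_pow]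
  have hc1 : ⟪((circlePoint c : (Metric.sphere (0 : EuclideanSpace ℝ (Fin 2)) 1)) : EuclideanSpace ℝ (Fin 2)), ((circlePoint c : (Metric.sphere (0 : EuclideanSpace ℝ (Fin 2)) 1)) : EuclideanSpace ℝ (Fin 2))⟫ = 1 := by
    rw [real_inner_self_eq_norm_sq, norm_eq_of_mem_sphere (circlePoint c), one_pow]
  have h1 : dist u (circlePoint c) ^ 2 = 2 - 2 * angCos c u := by
    rw [Subtype.dist_eq, dist_eq_norm, ← real_inner_self_eq_norm_sq, inner_sub_left,
      inner_sub_right, inner_sub_right, hu1, hc1]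
    unfold angCos
    rw [real_inner_comm ((circlePoint c : (Metric.sphere (0 : EuclideanSpace ℝ (Fin 2)) 1)) : EuclideanSpace ℝ (Fin 2)) ((u : (Metric.sphere (0 : EuclideanSpace ℝ (Fin 2)) 1)) : EuclideanSpace ℝ (Fin 2))]
    ring
  have h2 : dist u (circlePoint c) ^ 2 ≤ β ^ 2 := by
    rw [h1]
    have := Real.one_sub_sq_div_two_le_cos (x := β)
    nlinarith
  exact (pow_le_pow_iff_left₀ dist_nonneg hβ two_ne_zero).1 h2

/-- **Grid cover.**  For `δ₀ > 0` and `0 < α ≤ π` there are finitely many centres `(τᵢ, cᵢ)` with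
`τᵢ ∈ [1/4, 3/4]` such that the compact rectangles `[τᵢ - δ₀, τᵢ + δ₀] × circleClosedArc cᵢ α`
cover `[1/4, 3/4] × S¹` (a uniform grid in time and angle). [folklore] -/
theorem exists_grid_cover {δ₀ α : ℝ} (hδ₀ : 0 < δ₀) (hα : 0 < α) (hαπ : α ≤ π) :
    ∃ (N M : ℕ) (τ c : Fin (N + 1) × Fin (M + 1) → ℝ),
      (∀ i, τ i ∈ Icc (1 / 4 : ℝ) (3 / 4)) ∧
      ∀ p : ℝ × (Metric.sphere (0 : EuclideanSpace ℝ (Fin 2)) 1), p.1 ∈ Icc (1 / 4 : ℝ) (3 / 4) →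
        ∃ i, p ∈ Icc (τ i - δ₀) (τ i + δ₀) ×ˢ circleClosedArc (c i) α := by
  set N : ℕ := ⌊(1 / 2 : ℝ) / δ₀⌋₊ with hN
  set M : ℕ := ⌊(2 * π) / α⌋₊ with hM
  refine ⟨N, M, fun i => 1 / 4 + δ₀ * (i.1 : ℕ), fun i => α * (i.2 : ℕ), fun i => ?_, ?_⟩
  · have hk : ((i.1 : ℕ) : ℝ) ≤ N := by exact_mod_cast Nat.le_of_lt_succ i.1.2
    have hNle : (N : ℝ) ≤ (1 / 2 : ℝ) / δ₀ := Nat.floor_le (by positivity)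
    have h0 : (0 : ℝ) ≤ δ₀ * (i.1 : ℕ) := by positivity
    have h1 : δ₀ * ((i.1 : ℕ) : ℝ) ≤ δ₀ * ((1 / 2 : ℝ) / δ₀) :=
      mul_le_mul_of_nonneg_left (hk.trans hNle) hδ₀.le
    rw [mul_div_cancel₀ _ hδ₀.ne'] at h1
    exact ⟨by linarith, by linarith⟩
  · rintro ⟨t, u⟩ ⟨ht1, ht2⟩
    -- the time index
    set k : ℕ := ⌊(t - 1 / 4) / δ₀⌋₊ with hk
    have hk0 : (0 : ℝ) ≤ (t - 1 / 4) / δ₀ := div_nonneg (by linarith) hδ₀.le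
    have hkN : k ≤ N := Nat.floor_le_floor (div_le_div_of_nonneg_right (by linarith) hδ₀.le)
    have hk1 : (k : ℝ) ≤ (t - 1 / 4) / δ₀ := Nat.floor_le hk0
    have hk2 : (t - 1 / 4) / δ₀ < k + 1 := Nat.lt_floor_add_one _
    have hk1' : δ₀ * (k : ℝ) ≤ t - 1 / 4 := by
      have := mul_le_mul_of_nonneg_left hk1 hδ₀.le
      rwa [mul_div_cancel₀ _ hδ₀.ne'] at this
    have hk2' : t - 1 / 4 < δ₀ * ((k : ℝ) + 1) := by
      have := mul_lt_mul_of_pos_left hk2 hδ₀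
      rwa [mul_div_cancel₀ _ hδ₀.ne'] at this
    -- the angle index
    obtain ⟨θ₀, rfl⟩ := circlePoint_surjective u
    set θ : ℝ := toIcoMod Real.two_pi_pos 0 θ₀ with hθ
    have hθmem : θ ∈ Ico (0 : ℝ) (0 + 2 * π) := toIcoMod_mem_Ico _ _ _
    have hθcp : circlePoint θ = circlePoint θ₀ := by
      rw [circlePoint_eq_circlePoint_iff]
      refine ⟨-toIcoDiv Real.two_pi_pos 0 θ₀, ?_⟩
      rw [hθ, toIcoMod]
      push_cast
      ring
    set l : ℕ := ⌊θ / α⌋₊ with hl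
    have hl0 : 0 ≤ θ / α := div_nonneg hθmem.1 hα.le
    have hlM : l ≤ M := by
      refine Nat.floor_le_floor (div_le_div_of_nonneg_right ?_ hα.le)
      linarith [hθmem.2]
    have hl1 : (l : ℝ) ≤ θ / α := Nat.floor_le hl0
    have hl2 : θ / α < l + 1 := Nat.lt_floor_add_one _
    have hl1' : α * (l : ℝ) ≤ θ := by
      have := mul_le_mul_of_nonneg_left hl1 hα.le
      rwa [mul_div_cancel₀ _ hα.ne'] at this
    have hl2' : θ < α * ((l : ℝ) + 1) := by
      have := mul_lt_mul_of_pos_left hl2 hα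
      rwa [mul_div_cancel₀ _ hα.ne'] at this
    refine ⟨(⟨k, Nat.lt_succ_of_le hkN⟩, ⟨l, Nat.lt_succ_of_le hlM⟩), ⟨?_, ?_⟩, ?_⟩
    · change 1 / 4 + δ₀ * (k : ℝ) - δ₀ ≤ t
      linarith
    · change t ≤ 1 / 4 + δ₀ * (k : ℝ) + δ₀
      linarith
    · change circlePoint θ₀ ∈ circleClosedArc (α * (l : ℝ)) α
      rw [← hθcp]
      refine circlePoint_mem_circleClosedArc_of_abs_le (abs_le.2 ⟨by linarith, by linarith⟩) hαπ

end Cover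

/-! ### Whitney's theorem for circles: the general-position part -/

section Whitney

variable [IsManifold (𝓡 n) ∞ V]

/-- **Whitney (1936) for circles in dimension `≥ 4`, general-position part.**  Let `V` be a
Hausdorff `n`-manifold without boundary, `4 ≤ n`, let `e₀ e₁ : S¹ → V` be smooth embeddings and
`H : ℝ × S¹ → V` a smooth map with `H (t, ·) = e₀` for `t ≤ 1/4` and `H (t, ·) = e₁` for
`t ≥ 3/4` (a smooth homotopy through arbitrary maps, constant near the ends).  Then `e₀` and `e₁`
are smoothly isotopic: the homotopy can be perturbed, rectangle by rectangle in charts of `V` and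
off the ends, into a jointly smooth family of smooth embeddings (Whitney, *Differentiable
manifolds* (1936), §II Thm. 6: homotopic imbeddings `Mᵐ → Nⁿ` are isotopic for `n ≥ 2m + 2`;
Milnor (1965), Thm. 8.4 and Remark).
[cite: Whitney1936, §II Thm. 6 and §§8–9] -/
theorem isSmoothlyIsotopic_of_contMDiff_homotopy [T2Space V] (hn : 4 ≤ n) {H : ℝ × (Metric.sphere (0 : EuclideanSpace ℝ (Fin 2)) 1) → V}
    (hH : ContMDiff (𝓘(ℝ, ℝ).prod (𝓡 1)) (𝓡 n) ∞ H) {e₀ e₁ : (Metric.sphere (0 : EuclideanSpace ℝ (Fin 2)) 1) → V}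
    (he₀ : Manifold.IsSmoothEmbedding (𝓡 1) (𝓡 n) ∞ e₀)
    (he₁ : Manifold.IsSmoothEmbedding (𝓡 1) (𝓡 n) ∞ e₁)
    (h₀ : ∀ t : ℝ, t ≤ 1 / 4 → ∀ u, H (t, u) = e₀ u)
    (h₁ : ∀ t : ℝ, 3 / 4 ≤ t → ∀ u, H (t, u) = e₁ u) :
    IsSmoothlyIsotopic (𝓡 1) (𝓡 n) e₀ e₁ := by
  -- ### the initial good set
  set A₀ : Set (ℝ × (Metric.sphere (0 : EuclideanSpace ℝ (Fin 2)) 1)) := {p | p.1 ≤ 1 / 4 ∨ 3 / 4 ≤ p.1} with hA₀def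
  have hA₀ : StagesGoodOn n H A₀ := by
    refine ⟨fun t s hts => ?_, fun t u u' htu heq => ?_⟩
    · rcases hts with ht | ht
      · rw [thetaVel_eq_of_stage_eq (G := fun p : ℝ × (Metric.sphere (0 : EuclideanSpace ℝ (Fin 2)) 1) => e₀ p.2) (t' := t)
          (fun u => h₀ t ht u) s]
        exact thetaVel_const_ne_zero he₀.contMDiff he₀.isImmersion t s
      · rw [thetaVel_eq_of_stage_eq (G := fun p : ℝ × (Metric.sphere (0 : EuclideanSpace ℝ (Fin 2)) 1) => e₁ p.2) (t' := t)
          (fun u => h₁ t ht u) s]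
        exact thetaVel_const_ne_zero he₁.contMDiff he₁.isImmersion t s
    · rcases htu with ht | ht
      · rw [h₀ t ht, h₀ t ht] at heq
        exact he₀.isEmbedding.injective heq
      · rw [h₁ t ht, h₁ t ht] at heq
        exact he₁.isEmbedding.injective heq
  -- ### a Lebesgue number for the cover of `[1/4, 3/4] × S¹` by preimages of chart sources
  set Q : Set (ℝ × (Metric.sphere (0 : EuclideanSpace ℝ (Fin 2)) 1)) := Icc (1 / 4 : ℝ) (3 / 4) ×ˢ univ with hQdef
  have hQc : IsCompact Q := isCompact_Icc.prod isCompact_univ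
  obtain ⟨lam, hlam, hleb⟩ := lebesgue_number_lemma_of_metric hQc
    (c := fun y : V => H ⁻¹' (chartAt (EuclideanSpace ℝ (Fin n)) y).source)
    (fun y => (chartAt (EuclideanSpace ℝ (Fin n)) y).open_source.preimage hH.continuous)
    (fun p _ => mem_iUnion.2 ⟨H p, mem_chart_source _ _⟩)
  haveI : Nonempty V := ⟨e₀ (circlePoint 0)⟩
  choose! yc hyc using hleb
  -- ### sizes of the rectangles
  set δ₀ : ℝ := min (lam / 4) (1 / 16) with hδ₀def
  set α : ℝ := min (lam / 4) (1 / 4) with hαdef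
  have hδ₀ : 0 < δ₀ := lt_min (by linarith) (by norm_num)
  have hδ₀lam : 3 * δ₀ < lam := by
    have : δ₀ ≤ lam / 4 := min_le_left _ _
    linarith
  have hδ₀8 : 2 * δ₀ ≤ 1 / 8 := by
    have : δ₀ ≤ 1 / 16 := min_le_right _ _
    linarith
  have hα : 0 < α := lt_min (by linarith) (by norm_num)
  have hαlam : 3 * α < lam := by
    have : α ≤ lam / 4 := min_le_left _ _
    linarith
  have h3α : 3 * α < π / 2 := by
    have : α ≤ 1 / 4 := min_le_right _ _
    linarith [Real.two_le_pi]
  have hαπ : α ≤ π := by linarith [Real.two_le_pi]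
  -- ### the grid and its chart centres
  obtain ⟨N, M, τ, c, hτ, hcover⟩ := exists_grid_cover hδ₀ hα hαπ
  set xc : Fin (N + 1) × Fin (M + 1) → V := fun i => yc (τ i, circlePoint (c i)) with hxcdef
  set K : Fin (N + 1) × Fin (M + 1) → Set (ℝ × (Metric.sphere (0 : EuclideanSpace ℝ (Fin 2)) 1)) := fun i =>
    Icc (τ i - δ₀) (τ i + δ₀) ×ˢ circleClosedArc (c i) α with hKdef
  set Rc : Fin (N + 1) × Fin (M + 1) → Set (ℝ × (Metric.sphere (0 : EuclideanSpace ℝ (Fin 2)) 1)) := fun i =>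
    Icc (τ i - 3 * δ₀) (τ i + 3 * δ₀) ×ˢ circleClosedArc (c i) (3 * α) with hRcdef
  have hRc0 : ∀ i, MapsTo H (Rc i) (chartAt (EuclideanSpace ℝ (Fin n)) (xc i)).source := by
    intro i p hp
    have hQi : ((τ i, circlePoint (c i)) : ℝ × (Metric.sphere (0 : EuclideanSpace ℝ (Fin 2)) 1)) ∈ Q := ⟨hτ i, mem_univ _⟩
    have hball := hyc _ hQi
    apply hball
    rw [Metric.mem_ball, Prod.dist_eq, max_lt_iff]
    refine ⟨?_, ?_⟩
    · rw [Real.dist_eq, abs_lt]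
      obtain ⟨h1, h2⟩ := hp.1
      exact ⟨by linarith, by linarith⟩
    · exact (dist_le_of_mem_circleClosedArc (by linarith) hp.2).trans_lt hαlam
  -- ### induction over the rectangles of the grid
  have hind : ∀ S : Finset (Fin (N + 1) × Fin (M + 1)), ∃ G : ℝ × (Metric.sphere (0 : EuclideanSpace ℝ (Fin 2)) 1) → V,
      ContMDiff (𝓘(ℝ, ℝ).prod (𝓡 1)) (𝓡 n) ∞ G ∧ StagesGoodOn n G (A₀ ∪ ⋃ i ∈ S, K i) ∧
      (∀ j, MapsTo G (Rc j) (chartAt (EuclideanSpace ℝ (Fin n)) (xc j)).source) ∧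
      ∀ p : ℝ × (Metric.sphere (0 : EuclideanSpace ℝ (Fin 2)) 1), p.1 ∉ Ioo (1 / 8 : ℝ) (7 / 8) → G p = H p := by
    intro S
    induction S using Finset.induction_on with
    | empty =>
      refine ⟨H, hH, ?_, hRc0, fun p _ => rfl⟩
      simpa using hA₀
    | @insert i S hiS ih =>
      obtain ⟨G, hGs, hGA, hGRc, hGH⟩ := ih
      obtain ⟨q, hG's, hG'A, hG'Rc, hG'eq⟩ := exists_chartPerturb_stagesGoodOn hn hGs hGA hδ₀ hα
        h3α (x := xc i) (hGRc i) (fun j => isCompact_closedRect (τ j) δ₀ (c j) α)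
        (fun j => (chartAt (EuclideanSpace ℝ (Fin n)) (xc j)).open_source) hGRc
      refine ⟨_, hG's, ?_, hG'Rc, fun p hp => ?_⟩
      · refine hG'A.mono ?_
        intro p hp
        rw [Finset.set_biUnion_insert] at hp
        rcases hp with hp | hp | hp
        · exact Or.inl (Or.inl hp)
        · exact Or.inr hp
        · exact Or.inl (Or.inr hp)
      · rw [hG'eq p ?_, hGH p hp]
        apply rectBump_eq_zero_of_time hδ₀
        intro ht
        apply hp
        obtain ⟨hτ1, hτ2⟩ := hτ i
        exact ⟨by linarith [ht.1], by linarith [ht.2]⟩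
  obtain ⟨G, hGs, hGA, -, hGH⟩ := hind Finset.univ
  -- ### every stage of the final family is good
  have hgood : StagesGoodOn n G univ := by
    refine hGA.mono fun p _ => ?_
    by_cases hp : p.1 ∈ Icc (1 / 4 : ℝ) (3 / 4)
    · obtain ⟨i, hi⟩ := hcover p hp
      exact Or.inr (mem_iUnion₂.2 ⟨i, Finset.mem_univ i, hi⟩)
    · refine Or.inl ?_
      rw [mem_Icc, not_and_or, not_le, not_le] at hp
      rcases hp with hp | hp
      · exact Or.inl hp.le
      · exact Or.inr hp.le
  -- ### the smooth isotopy
  refine ⟨{ toFun := fun t u => G (t, u)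
            contMDiff := hGs
            isSmoothEmbedding := fun t => isSmoothEmbedding_stage hGs hgood t
            map_zero := ?_
            map_one := ?_ }⟩
  · funext u
    rw [hGH (0, u) (fun h => absurd h.1 (by norm_num)), h₀ 0 (by norm_num) u]
  · funext u
    rw [hGH (1, u) (fun h => absurd h.2 (by norm_num)), h₁ 1 (by norm_num) u]

end Whitney


end Literature.Topology.FourManifolds
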